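import Summits.CriticalPhenomena.PercolationContinuityZ3.Theorems.Transplant.SkelNegBParamsRootVals
import Summits.CriticalPhenomena.PercolationContinuityZ3.Theorems.Transplant.SkelNegBParamsRootLamA
import Summits.CriticalPhenomena.PercolationContinuityZ3.Theorems.Transplant.SkelNegBParamsRootArithA
import HarnessLib

/-!
# N1 params, chain of record `NegB`, part RootVals-A — the (ζ′) twin of part RootVals §2 at `A := Aof κ = 20·K`: THE STRIDE UNITS **`KS.u₀A := s₀`, `KS.u₁A := s₁`**
# (ONE lattice period = `s_i` fine cells: `c_i = A·u_iA`; the kit square is `r_i = K·u_iA = 40·Kq` strides, the arrival box `b0TA_i = 10·Kq·u_iA`), THE RUN ORIGIN's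
# FINE ABSCISSA **`KS.FcA y := coarse c₀ (D_A/2) D_A (lam0 A v_L v_β y)`** with the exact reduction **`FcA_eq : FcA y = (2·u₀A·Λ₀(y) + m)/(2m)`** (`A` even), and THE STRIDE
# COUNT **`KS.NrOfA σ y := round((800·Kq·u₀A − σ·FcA)/u₀A) − 1`** (the run ends at the next cell centre `20r₀ = 800·Kq` strides) with
# **`NrOfA_spec : 1 + NrOfA ≤ 1000·Kq ∧ |FcA + σ·u₀A·(NrOfA+1) − σ·800·Kq·u₀A| ≤ u₀A`** (stmt-g16 2026-08-22; NEG-SCOPE §B.19 (ζ′): 'every stride count ×Kq';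
# the boxes `Wrun/Lbrun/paLo…lbHi/hprism_R/hlastc_R` and the functionals `Λ₀of/Λ₁of` are part RootVals', cell-free, reused)
builds on p205010 (kernel theorem, internal audit signed; external expert review pending) — nothing in this file uses p205010; NOTHING is claimed about the node
`SamePDropOfSkeletonNeg₁` (OPEN).
Lane `prim-bschramm-*`, seat `prim-bschramm-stmt` (gen 16); helper file (`--supports stmt-CriticalPhenomena-4575 --as helper`); ledger HOME/prim-bschramm-stmt/NEG-PARAMS.md.
* **`u₀A/u₁A`**, **`units_eqA`**, `DofA_eq'`, `lam_eqA`, **`FcA`**, `FcA_eq_lit`, **`FcA_eq`**,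
  **`NrOfA`**, **`NrOfA_spec`**, `hnF_RA` (hp-8's `hnFx`: `0+1+NrOfA+1+N₃ ≤ nFA` for `N₃ ≤ 998·Kq`).
[cite: KozmaNitzan2024, §4 p. 28 ((32) at the root), Lemma 11 (p. 22: the target boxes)] [cite: MartineauTassion2017, §4.3 Lemma 4.2]
-/

noncomputable section

open scoped Classical

namespace Summit.CriticalPhenomena.PercolationContinuityZ3.Theorems.Transplant

namespace PlanarSkeletonNeg

namespace NegB

namespace KS

open Literature.Probability.Percolation Literature.Probability.LatticeModels SimpleGraph
open SkelConc (Consts)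
open Skelφ.StepI (DataN)
open TwoAxis.Para (modulus)
open Neg

section Origin

variable (κ : Consts) {V : Type} [DecidableEq V] [Countable V] {G : SimpleGraph V} [G.LocallyFinite] (Φ : PlanarSkeletonNeg G) (t : V)
  (p : unitInterval) (D : DataN V) (g f : ℕ)

/-- **The stride unit along axis `0` of the (ζ′) chain: `u₀A := s₀`** (one period = `s₀` cells; `c₀ = A·u₀A`, `r₀ = K·u₀A`, `b0TA₀ = 10·Kq·u₀A`). [this work] -/
def u₀A : ℤ := (((fcellsA κ Φ t p D g f).s 0 : ℕ) : ℤ)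

/-- **The stride unit along axis `1` of the (ζ′) chain: `u₁A := s₁`.** [this work] -/
def u₁A : ℤ := (((fcellsA κ Φ t p D g f).s 1 : ℕ) : ℤ)

/-- The (ζ′) literals in stride units: `c₀ = A·u₀A`, `c₁ = A·u₁A`, `r₀ = 40Kq·u₀A`, `r₁ = 40Kq·u₁A`, `b0TA₀ = 10Kq·u₀A`, `b0TA₁ = 10Kq·u₁A`, `1 ≤ u₀A`, `1 ≤ u₁A`. [folklore] -/
theorem units_eqA : 20 * ((fcellsA κ Φ t p D g f).K : ℤ) * (((fcellsA κ Φ t p D g f).s 0 : ℕ) : ℤ) = Aof κ * u₀A κ Φ t p D g f ∧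
    20 * ((fcellsA κ Φ t p D g f).K : ℤ) * (((fcellsA κ Φ t p D g f).s 1 : ℕ) : ℤ) = Aof κ * u₁A κ Φ t p D g f ∧
    ((fcellsA κ Φ t p D g f).r 0 : ℤ) = 40 * (Neg.Kq κ : ℤ) * u₀A κ Φ t p D g f ∧ ((fcellsA κ Φ t p D g f).r 1 : ℤ) = 40 * (Neg.Kq κ : ℤ) * u₁A κ Φ t p D g f ∧
    (b0TA κ Φ t p D g f 0 : ℤ) = 10 * (Neg.Kq κ : ℤ) * u₀A κ Φ t p D g f ∧ (b0TA κ Φ t p D g f 1 : ℤ) = 10 * (Neg.Kq κ : ℤ) * u₁A κ Φ t p D g f ∧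
    1 ≤ u₀A κ Φ t p D g f ∧ 1 ≤ u₁A κ Φ t p D g f := by
  have hr := (fcellsA_K κ Φ t p D g f).2.2
  have hs0 : (1 : ℤ) ≤ (((fcellsA κ Φ t p D g f).s 0 : ℕ) : ℤ) := by exact_mod_cast (fcellsA κ Φ t p D g f).hs 0
  have hs1 : (1 : ℤ) ≤ (((fcellsA κ Φ t p D g f).s 1 : ℕ) : ℤ) := by exact_mod_cast (fcellsA κ Φ t p D g f).hs 1
  unfold u₀A u₁A
  refine ⟨c_eq_A_mul_s κ Φ t p D g f 0, c_eq_A_mul_s κ Φ t p D g f 1, ?_, ?_, ?_, ?_, hs0, hs1⟩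
  · rw [hr 0, Neg.K_eq]; push_cast; ring
  · rw [hr 1, Neg.K_eq]; push_cast; ring
  · rw [b0TA_eq]; push_cast; ring
  · rw [b0TA_eq]; push_cast; ring

/-- `D_A = A²·m`. [folklore] -/
theorem DofA_eq' : Skelφ.NegPrm.DofA (Aof κ) (nL κ Φ t p D g f) (hL κ Φ t p D g f) (ℓL κ Φ t p D g f) (vL κ Φ t p D g f) =
    (Aof κ) ^ 2 * modulus (nL κ Φ t p D g f) (hL κ Φ t p D g f) (vL κ Φ t p D g f) (Skelφ.NegPrm.vβOf (nL κ Φ t p D g f) (hL κ Φ t p D g f) (ℓL κ Φ t p D g f) (vL κ Φ t p D g f)) :=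
  Skelφ.NegPrm.DofA_eq _ _ _ _ _

/-- `lam0 A v_L v_β y = A·Λ₀(y)`, `lam1 A n_L h_L y = A·Λ₁(y)`. [folklore] -/
theorem lam_eqA (y : Site 2) :
    TwoAxis.Para.lam0 (Aof κ) (vL κ Φ t p D g f) (Skelφ.NegPrm.vβOf (nL κ Φ t p D g f) (hL κ Φ t p D g f) (ℓL κ Φ t p D g f) (vL κ Φ t p D g f)) y = Aof κ * Λ₀of κ Φ t p D g f y ∧
      TwoAxis.Para.lam1 (Aof κ) (nL κ Φ t p D g f : ℤ) (hL κ Φ t p D g f) y = Aof κ * Λ₁of κ Φ t p D g f y := ⟨rfl, rfl⟩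

/-- **The run origin's fine abscissa of the (ζ′) chain** `FcA(y) := coarse c₀ (D_A/2) D_A (lam0 A v_L v_β y)` (p3's literal over `prFA`). [this work] -/
def FcA (y : Site 2) : ℤ :=
  TwoAxis.Para.coarse (20 * ((fcellsA κ Φ t p D g f).K : ℤ) * (((fcellsA κ Φ t p D g f).s 0 : ℕ) : ℤ))
    (Skelφ.NegPrm.DofA (Aof κ) (nL κ Φ t p D g f) (hL κ Φ t p D g f) (ℓL κ Φ t p D g f) (vL κ Φ t p D g f) / 2)
    (Skelφ.NegPrm.DofA (Aof κ) (nL κ Φ t p D g f) (hL κ Φ t p D g f) (ℓL κ Φ t p D g f) (vL κ Φ t p D g f))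
    (TwoAxis.Para.lam0 (Aof κ) (vL κ Φ t p D g f) (Skelφ.NegPrm.vβOf (nL κ Φ t p D g f) (hL κ Φ t p D g f) (ℓL κ Φ t p D g f) (vL κ Φ t p D g f)) y)

/-- `FcA(y)` in the literal RootArith-A shape `(A·u₀A·(A·Λ₀(y)) + A²m/2)/(A²m)`. [folklore] -/
theorem FcA_eq_lit (y : Site 2) : FcA κ Φ t p D g f y =
    (Aof κ * u₀A κ Φ t p D g f * (Aof κ * Λ₀of κ Φ t p D g f y) +
        (Aof κ) ^ 2 * modulus (nL κ Φ t p D g f) (hL κ Φ t p D g f) (vL κ Φ t p D g f) (Skelφ.NegPrm.vβOf (nL κ Φ t p D g f) (hL κ Φ t p D g f) (ℓL κ Φ t p D g f) (vL κ Φ t p D g f)) / 2) /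
      ((Aof κ) ^ 2 * modulus (nL κ Φ t p D g f) (hL κ Φ t p D g f) (vL κ Φ t p D g f) (Skelφ.NegPrm.vβOf (nL κ Φ t p D g f) (hL κ Φ t p D g f) (ℓL κ Φ t p D g f) (vL κ Φ t p D g f))) := by
  unfold FcA TwoAxis.Para.coarse
  rw [(units_eqA κ Φ t p D g f).1, DofA_eq', (lam_eqA κ Φ t p D g f y).1]

/-- **`FcA(y) = (2·u₀A·Λ₀(y) + m)/(2m)`** (`A = 20K` is even and cancels). [folklore] -/
theorem FcA_eq (y : Site 2) : FcA κ Φ t p D g f y =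
    (2 * u₀A κ Φ t p D g f * Λ₀of κ Φ t p D g f y + modulus (nL κ Φ t p D g f) (hL κ Φ t p D g f) (vL κ Φ t p D g f) (vβL κ Φ t p D g f)) /
      (2 * modulus (nL κ Φ t p D g f) (hL κ Φ t p D g f) (vL κ Φ t p D g f) (vβL κ Φ t p D g f)) := by
  have hAe : 2 ∣ Aof κ := ⟨10 * (Neg.K κ : ℤ), by rw [Aof_eq_K]; ring⟩
  unfold FcA TwoAxis.Para.coarse
  rw [(units_eqA κ Φ t p D g f).1, DofA_eq', (lam_eqA κ Φ t p D g f y).1]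
  exact RootArithA.coarse_cancel (Aof_pos κ).1 hAe

/-- **THE STRIDE COUNT OF THE (ζ′) CHAIN** `NrOfA := round((800·Kq·u₀A − σ·FcA)/u₀A) − 1` (so that `FcA + σu₀A(NrA+1) ≈ σ·800·Kq·u₀A = σ·20r₀`). [this work] -/
def NrOfA (σ : ℤ) (y : Site 2) : ℕ :=
  Int.toNat ((800 * (Neg.Kq κ : ℤ) * u₀A κ Φ t p D g f - σ * FcA κ Φ t p D g f y + u₀A κ Φ t p D g f / 2) / u₀A κ Φ t p D g f - 1)

/-- **The (ζ′) stride count is admissible and centred**: `1 + NrOfA ≤ 1000·Kq` and `|FcA + σ·u₀A·(NrOfA+1) − σ·800·Kq·u₀A| ≤ u₀A`, whenever `|Λ₀(y)| ≤ 3m` (`σ = ±1`).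
[cite: KozmaNitzan2024, §4 Lemma 11 (p. 22)] -/
theorem NrOfA_spec (hN : EqNumL κ Φ t p D g f) {σ : ℤ} (hσ : σ = 1 ∨ σ = -1) (y : Site 2)
    (hΛ : |Λ₀of κ Φ t p D g f y| ≤ 3 * modulus (nL κ Φ t p D g f) (hL κ Φ t p D g f) (vL κ Φ t p D g f) (vβL κ Φ t p D g f)) :
    0 + 1 + NrOfA κ Φ t p D g f σ y ≤ 1000 * Neg.Kq κ ∧
      |FcA κ Φ t p D g f y + σ * u₀A κ Φ t p D g f * ((NrOfA κ Φ t p D g f σ y : ℤ) + 1) - σ * (800 * (Neg.Kq κ : ℤ)) * u₀A κ Φ t p D g f| ≤ u₀A κ Φ t p D g f := by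
  obtain ⟨hn1, hℓ1⟩ := one_le_of_eqNumL κ Φ t p D g f hN
  have hm : 0 < modulus (nL κ Φ t p D g f) (hL κ Φ t p D g f) (vL κ Φ t p D g f) (vβL κ Φ t p D g f) := Skelφ.NegPrm.modulus_vβOf_pos hn1 hℓ1 _ _
  have hu : 1 ≤ u₀A κ Φ t p D g f := (units_eqA κ Φ t p D g f).2.2.2.2.2.2.1
  have hq : (1 : ℤ) ≤ Neg.Kq κ := by exact_mod_cast Neg.one_le_Kq κ
  have hF := FcA_eq κ Φ t p D g f y
  obtain ⟨f1, f2⟩ := RootArith.floor_sandwich (x := 2 * u₀A κ Φ t p D g f * Λ₀of κ Φ t p D g f y + modulus (nL κ Φ t p D g f) (hL κ Φ t p D g f) (vL κ Φ t p D g f) (vβL κ Φ t p D g f))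
    (d := 2 * modulus (nL κ Φ t p D g f) (hL κ Φ t p D g f) (vL κ Φ t p D g f) (vβL κ Φ t p D g f)) (by linarith)
  rw [← hF] at f1 f2
  set F := FcA κ Φ t p D g f y
  set u := u₀A κ Φ t p D g f
  set Q := (Neg.Kq κ : ℤ)
  set m := modulus (nL κ Φ t p D g f) (hL κ Φ t p D g f) (vL κ Φ t p D g f) (vβL κ Φ t p D g f)
  obtain ⟨hΛ1, hΛ2⟩ := abs_le.1 hΛ
  have huΛlo : u * (-(3 * m)) ≤ u * Λ₀of κ Φ t p D g f y := mul_le_mul_of_nonneg_left hΛ1 (by linarith)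
  have huΛhi : u * Λ₀of κ Φ t p D g f y ≤ u * (3 * m) := mul_le_mul_of_nonneg_left hΛ2 (by linarith)
  have hFlo : -3 * u ≤ F := by
    by_contra hc; push Not at hc
    have h1 : 2 * m * F ≤ 2 * m * (-3 * u - 1) := mul_le_mul_of_nonneg_left (by linarith) (by linarith)
    nlinarith
  have hFhi : F ≤ 3 * u := by
    by_contra hc; push Not at hc
    have h1 : 2 * m * (3 * u + 1) ≤ 2 * m * F := mul_le_mul_of_nonneg_left (by linarith) (by linarith)
    nlinarith
  obtain ⟨d1, d2⟩ := RootArith.floor_sandwich (x := u) (d := 2) (by norm_num)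
  have hu0 : 0 < u := by linarith
  obtain ⟨x1, x2⟩ := RootArith.floor_sandwich (x := 800 * Q * u - σ * F + u / 2) (d := u) hu0
  set X := (800 * Q * u - σ * F + u / 2) / u
  have hσF : |σ * F| ≤ 3 * u := by
    rcases hσ with rfl | rfl
    · rw [one_mul]; exact abs_le.2 ⟨by linarith, hFhi⟩
    · rw [neg_one_mul, abs_neg]; exact abs_le.2 ⟨by linarith, hFhi⟩
  obtain ⟨s1, s2⟩ := abs_le.1 hσF
  have hQu : u ≤ Q * u := by nlinarith
  have hXlo : 800 * Q - 4 ≤ X := by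
    by_contra hc; push Not at hc
    have : u * X ≤ u * (800 * Q - 5) := mul_le_mul_of_nonneg_left (by linarith) hu0.le
    nlinarith
  have hXhi : X ≤ 800 * Q + 4 := by
    by_contra hc; push Not at hc
    have : u * (800 * Q + 5) ≤ u * X := mul_le_mul_of_nonneg_left (by linarith) hu0.le
    nlinarith
  have hNr : (NrOfA κ Φ t p D g f σ y : ℤ) = X - 1 := by
    show (Int.toNat ((800 * Q * u - σ * F + u / 2) / u - 1) : ℤ) = X - 1
    rw [Int.toNat_of_nonneg (by linarith)]
  constructor
  · have : ((0 + 1 + NrOfA κ Φ t p D g f σ y : ℕ) : ℤ) ≤ ((1000 * Neg.Kq κ : ℕ) : ℤ) := by push_cast; rw [hNr]; linarith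
    exact_mod_cast this
  · rw [hNr, abs_le]
    have e : u * X = u * (X - 1 + 1) := by ring
    rcases hσ with rfl | rfl
    · simp only [one_mul] at x1 x2 ⊢
      constructor <;> linarith
    · simp only [neg_mul, one_mul, sub_neg_eq_add] at x1 x2 ⊢
      constructor <;> linarith

/-- **hp-8's schedule-index room `hnFx`** at the (ζ′) count: `0 + 1 + NrOfA + 1 + N₃ ≤ nFA κ.K₀ (= 2000·Kq)` for any face-kit count `N₃ ≤ 998·Kq`
(`1 + NrOfA ≤ 1000·Kq`). [folklore] -/
theorem hnF_RA (hN : EqNumL κ Φ t p D g f) {σ : ℤ} (hσ : σ = 1 ∨ σ = -1) (y : Site 2)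
    (hΛ : |Λ₀of κ Φ t p D g f y| ≤ 3 * modulus (nL κ Φ t p D g f) (hL κ Φ t p D g f) (vL κ Φ t p D g f) (vβL κ Φ t p D g f))
    {N₃ : ℕ} (hN₃ : N₃ ≤ 998 * Neg.Kq κ) : 0 + 1 + NrOfA κ Φ t p D g f σ y + 1 + N₃ ≤ nFA κ.K₀ := by
  have h1 := (NrOfA_spec κ Φ t p D g f hN hσ y hΛ).1
  rw [(nFA_le_LfA κ.K₀).2, LfA_eq]
  omega

end Origin

end KS

end NegB

end PlanarSkeletonNeg

end Summit.CriticalPhenomena.PercolationContinuityZ3.Theorems.Transplant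

end
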